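import Summits.Langlands.Langlands.Theorems.FrobeniusUnitCarving

/-!
# `FrobeniusUnitCarvingKernel` — CENSUS TWIN, PART 2 of 2 of the lens-6 g33 node `FrobeniusUnitCarving` (decomp-langlands, barrier-complement carving)

Part 1 (`Summits.Langlands.Langlands.Theorems.FrobeniusUnitCarving`) holds the route-text copies FU `FrobeniusUnits`, UWA `UnitWeakAutomorphy`,
the node-only complement NUWA `NonUnitWeakAutomorphy`, the rung / S-case texts, the named dial `HasUnitFrobenius` and the kernel helpers I–II
(`FramedRep.norm_eq_one_of_isRoot_charpoly` — eigenvalues of compact-image representations are UNITS; `hasUnitFrobenius_of_finiteOrder`,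
`hasUnitFrobenius_of_compatibleFamily`, `hasAlgebraicFrobenius_of_hasUnitFrobenius`).  This part holds, in the SAME namespace: the local–global
helpers III (`exists_isRoot_charpoly_of_localGlobalCompatibleAt`, `norm_symm_eq_one_of_localGlobalCompatibleAt`,
`norm_symm_inv_eq_one_of_satakeFrobCompatibleAt`, `norm_symm_inv_eq_one_of_automorphicToGalois`, bodies of the 1066 proof file), the cells
`weakAut_iff_cells : B_w ↔ UWA ∧ NUWA` (B_w = `PrimeSwitchSplit.WeakGeometricAutomorphy`, stmt-Langlands-17414, BY NAME), `nuwa_of_fu : FU → NUWA`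
(the carved class is void), the seam `closes_host : FU → UWA → B_w`, `closes_awa : FU → UWA → AWA` (g32's residual, BY NAME), `closes_root`,
the comparison `fa_of_fu : FU → FA` / `uwa_of_awa : AWA → UWA` with g32 (tree decls BY NAME), the NECESSITY certificates
`fu_of_dirA_of_weakAut : (A) → B_w → FU` and `fu_of_langlands : Langlands → FU` (kernel), `cells_of_langlands`, `cells_iff_target_modA`, and the
BC5 rungs `finiteOrderUnitRung`, `compatibleFamilyUnitRung` with the S-case maps `artinCase_of_uwa`, `compatibleFamilyCase_of_target`,
`compatibleFamilyCase_of_uwa`.  0 sorry; axioms ⊆ {propext, Classical.choice, Quot.sound} (guards in the node file).  Supports stmt-Langlands-17414.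
-/

set_option linter.dupNamespace false -- project-wide option (lakefile weak.linter.dupNamespace); `Summit.Langlands.Langlands` is the mandated namespace
set_option linter.unusedVariables false
set_option linter.unusedSectionVars false

namespace Summit.Langlands.Langlands.Theorems.FrobeniusUnitCarving

open Filter Polynomial
open scoped NumberField
open Summit.Langlands.Langlands.Theorems.FrobeniusAlgebraicityCarving (FrobeniusAlgebraicity ArithmeticWeakAutomorphy ArtinCase
  HasAlgebraicFrobenius isAlgebraic_symm exists_eq_charpoly_of_hasFrobCharpolyAt)

open IsDedekindDomain NumberField Literature.NumberTheory.GaloisRepresentations Literature.NumberTheory.Automorphic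

/-! ### Kernel helpers, III: local–global compatibility puts Satake parameters into Frobenius spectra (from the 1066 proof file) -/

section LocalGlobal

open scoped MatrixGroups Matrix Classical
open Field Summit.Langlands Summit.Langlands.Langlands.Theorems.ReciprocityUpToIrreducibility

variable {F : Type} [Field F] [NumberField F] {ℓ' : ℕ} [Fact ℓ'.Prime] {n : ℕ}

/-- **rank `n ≥ 2`: local–global compatibility at `v ∤ ℓ'` makes `ι'⁻¹(a)` an EIGENVALUE of `ρ'` at the recipe Frobenius** — the body of the
tree's `LArithmeticOfAutToGal.norm_symm_le_one_of_localGlobalCompatibleAt` (1066 proof file) up to its last line, exposing the root. [folklore] -/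
theorem exists_isRoot_charpoly_of_localGlobalCompatibleAt (hn : 1 < n) (R : ReciprocityData F)
    {hcpt : isCompact_glFiniteIntegralLevel n F} (ι' : PadicAlgCl ℓ' ≃+* ℂ)
    (π : CuspidalAutomorphicRepData n F hcpt) (ρ' : FramedGaloisRep F (PadicAlgCl ℓ') n)
    {v : HeightOneSpectrum (𝓞 F)} (hv : ((ℓ' : ℕ) : 𝓞 F) ∉ v.asIdeal) {α : Multiset ℂ}
    (hα : π.1.HasSatakeParamAt v α) (hLG : LocalGlobalCompatibleAt R ι' π.1 ρ' v) {a : ℂ} (ha : a ∈ α) :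
    ∃ g : absoluteGaloisGroup F, (FramedRep.charpoly ρ' g).IsRoot (ι'.symm a) := by
  obtain ⟨πv, rv, rℂ, hloc, hWD, -, hT, r', hr', hc⟩ := hLG
  obtain ⟨-, -, hchar'⟩ := LocalLanglandsDatum.recGL_unramified_of_hasSatakeParamAt hn hcpt π v α hα
    (R.llc v) πv hloc r' hr'.isFrobSemisimple hc.symm
  obtain ⟨t, U, Φ, -, -, hΦ, -, -, hrec⟩ := hWD hv
  have hss : (rℂ.ρ Φ).charpoly = (α.map fun b => X - C b).prod := by
    obtain ⟨-, m, hm, hcm, hsum⟩ := hr'.2.2 Φ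
    rw [hsum, LinearMap.charpoly_add_eq_of_isNilpotent_of_commute hm hcm, hchar' Φ hΦ]
  set g : absoluteGaloisGroup F :=
    absGaloisRestrict F (v.adicCompletion F) (WeilGroup.toAbsGalois (v.adicCompletion F) Φ) with hg
  have hmat : LinearMap.toMatrix' (rv.ρ Φ) =
      ((ρ' g : GL (Fin n) (PadicAlgCl ℓ')) : Matrix (Fin n) (Fin n) (PadicAlgCl ℓ')) := by
    have h1 := hrec 1 1
    simp only [zpow_one, OneMemClass.coe_one, mul_one, map_one, toAdd_one, zero_smul, neg_zero,
      IsNilpotent.exp_zero] at h1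
    rw [h1, FramedRep.toWeilGroupHom_apply, FramedGaloisRep.toLocal_apply]
  have hmapch : (FramedRep.charpoly ρ' g).map (ι' : PadicAlgCl ℓ' →+* ℂ) = (α.map fun b => X - C b).prod := by
    rw [← hss, charpoly_eq_charpoly_toMatrix', hT.1 Φ, hmat, Matrix.charpoly_map]
    rfl
  refine ⟨g, ?_⟩
  refine Polynomial.IsRoot.of_map (f := (ι' : PadicAlgCl ℓ' →+* ℂ)) ?_ (ι' : PadicAlgCl ℓ' →+* ℂ).injective
  have hιa : (ι' : PadicAlgCl ℓ' →+* ℂ) (ι'.symm a) = a := ι'.apply_symm_apply a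
  rw [hιa, hmapch, Polynomial.IsRoot.def, Polynomial.eval_multiset_prod, Multiset.prod_eq_zero_iff, Multiset.map_map]
  exact Multiset.mem_map.mpr ⟨a, ha, by simp⟩

/-- rank `n ≥ 2`: **`ι'⁻¹(a)` is an `ℓ'`-adic UNIT** for every Satake entry `a` at `v ∤ ℓ'` of a `π` locally–globally compatible with some `ρ'`. [folklore] -/
theorem norm_symm_eq_one_of_localGlobalCompatibleAt (hn : 1 < n) (R : ReciprocityData F)
    {hcpt : isCompact_glFiniteIntegralLevel n F} (ι' : PadicAlgCl ℓ' ≃+* ℂ)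
    (π : CuspidalAutomorphicRepData n F hcpt) (ρ' : FramedGaloisRep F (PadicAlgCl ℓ') n)
    {v : HeightOneSpectrum (𝓞 F)} (hv : ((ℓ' : ℕ) : 𝓞 F) ∉ v.asIdeal) {α : Multiset ℂ}
    (hα : π.1.HasSatakeParamAt v α) (hLG : LocalGlobalCompatibleAt R ι' π.1 ρ' v) {a : ℂ} (ha : a ∈ α) :
    ‖ι'.symm a‖ = 1 := by
  obtain ⟨g, hg⟩ := exists_isRoot_charpoly_of_localGlobalCompatibleAt hn R ι' π ρ' hv hα hLG ha
  haveI : CompactSpace (absoluteGaloisGroup F) := absoluteGaloisGroup_compactSpace F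
  exact FramedRep.norm_eq_one_of_isRoot_charpoly ρ' g hg

/-- rank `1` pattern: **a Satake–Frobenius compatible `ρ'` makes `ι'⁻¹(a⁻¹)` an `ℓ'`-adic UNIT** (an arithmetic Frobenius exists and its
characteristic polynomial is `∏ (X - ι'⁻¹(a⁻¹))`). [folklore] -/
theorem norm_symm_inv_eq_one_of_satakeFrobCompatibleAt {hcpt : isCompact_glFiniteIntegralLevel n F}
    (ι' : PadicAlgCl ℓ' ≃+* ℂ) (π : AutomorphicRepData (AutomorphyDatum.gl n F hcpt))
    (ρ' : FramedGaloisRep F (PadicAlgCl ℓ') n) {v : HeightOneSpectrum (𝓞 F)} {α : Multiset ℂ}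
    (hα : π.HasSatakeParamAt v α) (hsat : SatakeFrobCompatibleAt ι' π ρ' v) {a : ℂ} (ha : a ∈ α) :
    ‖ι'.symm a⁻¹‖ = 1 := by
  obtain ⟨α', hα', -, hcp⟩ := hsat
  obtain rfl : α = α' := AutomorphicRepData.hasSatakeParamAt_unique_holds π hα hα'
  obtain ⟨𝔓, h𝔓⟩ := IsDedekindDomain.HeightOneSpectrum.primesAbove_nonempty v
  obtain ⟨σ, hσ⟩ := IsDedekindDomain.HeightOneSpectrum.exists_isArithFrobAt_of_mem_primesAbove_holds h𝔓
  have hch : FramedRep.charpoly ρ' σ = arithFrobPolyOfSatake ι' v.residueCard 1 α := hcp 𝔓 h𝔓 σ hσ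
  haveI : CompactSpace (absoluteGaloisGroup F) := absoluteGaloisGroup_compactSpace F
  refine FramedRep.norm_eq_one_of_isRoot_charpoly ρ' σ ?_
  rw [hch]
  refine Polynomial.isRoot_of_mem_roots ?_
  rw [roots_arithFrobPolyOfSatake]
  exact Multiset.mem_map.mpr ⟨a, ha, by simp⟩

/-- **both ranks: under direction (A) at `(F, n, ℓ')` for the avatar `ι'`, every Satake entry `a` at `v ∤ ℓ'` of an L-algebraic cuspidal `π`
satisfies `‖ι'⁻¹(a⁻¹)‖ = 1`.** [folklore] -/
theorem norm_symm_inv_eq_one_of_automorphicToGalois {R : ReciprocityData F} {hcpt : isCompact_glFiniteIntegralLevel n F}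
    (hAG : AutomorphicToGalois n R hcpt) (ι' : PadicAlgCl ℓ' ≃+* ℂ) (π : CuspidalAutomorphicRepData n F hcpt) (hL : π.1.IsLAlgebraic)
    {v : HeightOneSpectrum (𝓞 F)} (hv : ((ℓ' : ℕ) : 𝓞 F) ∉ v.asIdeal) {α : Multiset ℂ} (hα : π.1.HasSatakeParamAt v α)
    {a : ℂ} (ha : a ∈ α) : ‖ι'.symm a⁻¹‖ = 1 := by
  rcases Nat.lt_or_ge 1 n with hn | hn
  · obtain ⟨ρ', -, -, hcorr, -⟩ := hAG π hL ℓ' ι'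
    exact norm_symm_inv_eq_one ι' (norm_symm_eq_one_of_localGlobalCompatibleAt hn R ι' π ρ' hv hα (hcorr.2 v) ha)
  · have hcard : Multiset.card α = n := hα.card_eq
    have hpos : 0 < Multiset.card α := Multiset.card_pos_iff_exists_mem.mpr ⟨a, ha⟩
    obtain rfl : n = 1 := le_antisymm hn (by omega)
    obtain ⟨ρ', -, hρ', -⟩ := stub_rankOne_corresponds_away_unramified F ℓ' hcpt R ι' π hL
    exact norm_symm_inv_eq_one_of_satakeFrobCompatibleAt ι' π.1 ρ' hα (hρ' v hv ⟨α, hα⟩).1 ha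

end LocalGlobal

/-! ## Kernel: route texts ↔ the named dial; EXACTNESS of the carving; `closes_host`; comparison with g32 -/

section Kernel

open IsDedekindDomain NumberField Literature.NumberTheory.Automorphic Literature.NumberTheory.GaloisRepresentations

/-- FU IS the named dial under the Galois binders (definitional). [folklore] -/
theorem fu_iff_named : FrobeniusUnits ↔
    (∀ (K : Type) [Field K] [NumberField K] (n : ℕ), 0 < n → ∀ (ℓ : ℕ) [Fact ℓ.Prime] (ι : PadicAlgCl ℓ ≃+* ℂ)
      (ρ : FramedGaloisRep K (PadicAlgCl ℓ) n), ρ.toGaloisRep.IsIrreducible →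
      ((∀ᶠ v : IsDedekindDomain.HeightOneSpectrum (NumberField.RingOfIntegers K) in cofinite, ρ.IsUnramifiedAt v) ∧ ∀ (v : IsDedekindDomain.HeightOneSpectrum (NumberField.RingOfIntegers K)) (hv : ((ℓ : ℕ) : NumberField.RingOfIntegers K) ∈ v.asIdeal), (Literature.NumberTheory.PAdicHodge.fontainePstAdicCompletion v ℓ hv).IsDeRhamFramed (ρ.toLocal v)) →
      HasUnitFrobenius K ℓ ι ρ) :=
  ⟨fun h K _ _ n hn ℓ _ ι ρ hirr hgeo => h K n hn ℓ ι ρ hirr hgeo, fun h K _ _ n hn ℓ _ ι ρ hirr hgeo => h K n hn ℓ ι ρ hirr hgeo⟩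

/-- **EXACTNESS (kernel, excluded middle on the dial)**: `B_w ↔ UWA ∧ NUWA` — the carving loses nothing. [folklore] -/
theorem weakAut_iff_cells : Summit.Langlands.Langlands.Theses.PrimeSwitchSplit.WeakGeometricAutomorphy ↔
    (UnitWeakAutomorphy ∧ NonUnitWeakAutomorphy) := by
  constructor
  · intro h
    exact ⟨fun K _ _ n hcpt hn ℓ _ ι ρ hirr hgeo _ => h K n hcpt hn ℓ ι ρ hirr hgeo,
      fun K _ _ n hcpt hn ℓ _ ι ρ hirr hgeo _ => h K n hcpt hn ℓ ι ρ hirr hgeo⟩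
  · rintro ⟨hU, hN⟩ K _ _ n hcpt hn ℓ _ ι ρ hirr hgeo
    by_cases hunit : HasUnitFrobenius K ℓ ι ρ
    · exact hU K n hcpt hn ℓ ι ρ hirr hgeo hunit
    · exact hN K n hcpt hn ℓ ι ρ hirr hgeo hunit

/-- the residual is a restriction of the target: `B_w → UWA`. [folklore] -/
theorem uwa_of_target (h : Summit.Langlands.Langlands.Theses.PrimeSwitchSplit.WeakGeometricAutomorphy) : UnitWeakAutomorphy :=
  (weakAut_iff_cells.1 h).1

/-- **THE CARVED CLASS IS VOID UNDER FU**: `FU → NUWA`. [folklore] -/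
theorem nuwa_of_fu (hF : FrobeniusUnits) : NonUnitWeakAutomorphy :=
  fun K _ _ n _ hn ℓ _ ι ρ hirr hgeo hnot => absurd (hF K n hn ℓ ι ρ hirr hgeo) hnot

/-- **closes_host** — the deciding implication of the node: `FU → UWA → B_w` (kernel, mod NOTHING; honest one-line seam — the content is in the
pieces: FU's conclusion for `ρ` is exactly UWA's inserted hypothesis). [folklore] -/
theorem closes_host (hF : FrobeniusUnits) (hU : UnitWeakAutomorphy) :
    Summit.Langlands.Langlands.Theses.PrimeSwitchSplit.WeakGeometricAutomorphy :=
  weakAut_iff_cells.2 ⟨hU, nuwa_of_fu hF⟩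

/-- `ChildAssembly` holds (it is `closes_host`). [folklore] -/
theorem childAssembly_holds : Summit.Langlands.Langlands.Theorems.FrobeniusUnitCarving.ChildAssembly := closes_host

/-- **closes_root**: with the host route's other cruxes (W⁺ = `SatakeAvatarExistence` 17415, P = `PadicMemberCompatibility` 17534,
A = `CompatibilityAwayFromLR` 18084, R = `CanonicalReciprocityData` 17930; U = `AvatarConjugacy` PROVED, `AvatarConjugacy_holds`) the pieces
give `Langlands`, BY NAME through `PrimeSwitchSplit.closes`. [folklore] -/
theorem closes_root (hF : FrobeniusUnits) (hU : UnitWeakAutomorphy)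
    (hWp : Summit.Langlands.Langlands.Theses.PrimeSwitchSplit.SatakeAvatarExistence)
    (hPm : Summit.Langlands.Langlands.Theses.PrimeSwitchSplit.PadicMemberCompatibility)
    (hAw : Summit.Langlands.Langlands.Theses.PrimeSwitchSplit.CompatibilityAwayFromLR)
    (hR : Summit.Langlands.Langlands.Theses.PrimeSwitchSplit.CanonicalReciprocityData) : _root_.Langlands :=
  Summit.Langlands.Langlands.Theses.PrimeSwitchSplit.closes (closes_host hF hU) hWp hPm hAw hR
    Summit.Langlands.Langlands.Theses.PrimeSwitchSplit.AvatarConjugacy_holds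

/-! ### Comparison with g32 (both by NAME of the tree decls): the new crux is STRONGER, the new residual WEAKER -/

/-- **FU ⟹ FA** (g32's crux `Theorems.FrobeniusAlgebraicityCarving.FrobeniusAlgebraicity`, by name): FA is `ι`-free, so pick any avatar
(`PadicAlgCl.nonempty_ringEquiv_complex`) and descend unit-ness at `ℓ' ∈ {2, 3}` to algebraicity. [folklore] -/
theorem fa_of_fu (hF : FrobeniusUnits) : FrobeniusAlgebraicity := by
  intro K _ _ n hn ℓ _ ρ hirr hgeo
  obtain ⟨ι⟩ := PadicAlgCl.nonempty_ringEquiv_complex ℓ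
  exact hasAlgebraicFrobenius_of_hasUnitFrobenius ι ρ (hF K n hn ℓ ι ρ hirr hgeo)

/-- **AWA ⟹ UWA** (g32's residual, by name): a `ρ` with unit avatars has algebraic Frobenius roots, so AWA applies to it. [folklore] -/
theorem uwa_of_awa (hA : ArithmeticWeakAutomorphy) : UnitWeakAutomorphy :=
  fun K _ _ n hcpt hn ℓ _ ι ρ hirr hgeo hunit =>
    hA K n hcpt hn ℓ ι ρ hirr hgeo (hasAlgebraicFrobenius_of_hasUnitFrobenius ι ρ hunit)

/-- **closes_awa** — this node decides g32's residual too: `FU → UWA → ArithmeticWeakAutomorphy` (so the g32 child route's residual item is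
refined BY NAME: AWA ⟸ FU ∧ UWA, with UWA ⟸ AWA). [folklore] -/
theorem closes_awa (hF : FrobeniusUnits) (hU : UnitWeakAutomorphy) : ArithmeticWeakAutomorphy :=
  Summit.Langlands.Langlands.Theorems.FrobeniusAlgebraicityCarving.awa_of_target (closes_host hF hU)

/-- hence g32's cells from this node's: `FU ∧ UWA → FA ∧ AWA`. [folklore] -/
theorem g32cells_of_cells (h : FrobeniusUnits ∧ UnitWeakAutomorphy) : FrobeniusAlgebraicity ∧ ArithmeticWeakAutomorphy :=
  ⟨fa_of_fu h.1, closes_awa h.1 h.2⟩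

/-! ### Necessity: FU is S-implied IN KERNEL (mod nothing) -/

/-- the host crux `B_w` is S-implied (re-proved inline; = the private `weakAut_of_langlands` of the g32 twin). [folklore] -/
private theorem weakAut_of_langlands (hL : _root_.Langlands) : Summit.Langlands.Langlands.Theses.PrimeSwitchSplit.WeakGeometricAutomorphy := by
  intro K _ _ n hcpt hn ℓ _ ι ρ hirr hgeo
  obtain ⟨⟨Rec⟩, h⟩ := hL K
  obtain ⟨π, hπ, hcorr⟩ := (h Rec n hn hcpt).2 ℓ ι ρ hirr ⟨hgeo.1, fun v hv => hgeo.2 v hv⟩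
  exact ⟨π, hπ, hcorr.1⟩

/-- **FU IS IMPLIED BY (B_w AND DIRECTION (A) AT EVERY PRIME), IN KERNEL.**  Given `B_w`, the irreducible geometric `ρ` is Satake–Frobenius
compatible through `ι` with an L-algebraic cuspidal `π` at almost every `v`; a Frobenius polynomial of `ρ` at such a `v` is `∏ (X - ι⁻¹(a⁻¹))`
over the Satake parameter (`roots_arithFrobPolyOfSatake`; uniqueness through an actual Frobenius), so `ι β = a⁻¹`; and direction (A) for
`(K, n)` at the prime `ℓ'` and avatar `ι'` makes `ι'⁻¹(a⁻¹)` a unit whenever `v ∤ ℓ'` (`norm_symm_inv_eq_one_of_automorphicToGalois`: local–global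
compatibility + eigenvalues of compact-image representations are units). [folklore] -/
theorem fu_of_dirA_of_weakAut
    (hA : ∀ (K : Type) [Field K] [NumberField K] (n : ℕ) (hcpt : isCompact_glFiniteIntegralLevel n K), 0 < n →
      ∃ R : Summit.Langlands.ReciprocityData K, Summit.Langlands.AutomorphicToGalois n R hcpt)
    (hB : Summit.Langlands.Langlands.Theses.PrimeSwitchSplit.WeakGeometricAutomorphy) : FrobeniusUnits := by
  intro K _ _ n hn ℓ _ ι ρ hirr hgeo
  classical
  have hcpt : isCompact_glFiniteIntegralLevel n K := isCompact_glFiniteIntegralLevel_holds n K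
  obtain ⟨π, hπalg, hcomp⟩ := hB K n hcpt hn ℓ ι ρ hirr hgeo
  obtain ⟨R, hAR⟩ := hA K n hcpt hn
  filter_upwards [hcomp] with v hv P hP β hβ ℓ' _ ι' hvℓ'
  obtain ⟨α, hα, -, hFrob⟩ := hv
  obtain ⟨𝔓, h𝔓⟩ := v.primesAbove_nonempty
  obtain ⟨σ, hσ⟩ := HeightOneSpectrum.exists_isArithFrobAt_of_mem_primesAbove_holds h𝔓
  have hPeq : P = arithFrobPolyOfSatake ι v.residueCard 1 α := (hP 𝔓 h𝔓 σ hσ).symm.trans (hFrob 𝔓 h𝔓 σ hσ)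
  rw [hPeq, roots_arithFrobPolyOfSatake, Multiset.mem_map] at hβ
  obtain ⟨a, ha, rfl⟩ := hβ
  have hιβ : ι (ι.symm ((((Real.sqrt (v.residueCard : ℕ) : ℝ) : ℂ) ^ (1 - 1) * a)⁻¹)) = a⁻¹ := by simp
  rw [hιβ]
  exact norm_symm_inv_eq_one_of_automorphicToGalois hAR ι' π hπalg hvℓ' hα ha

/-- **FU IS S-IMPLIED (kernel, mod NOTHING)**: `Langlands → FU`. [folklore] -/
theorem fu_of_langlands (hL : _root_.Langlands) : FrobeniusUnits :=
  fu_of_dirA_of_weakAut (fun K _ _ n hcpt hn => by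
    obtain ⟨⟨Rec⟩, h⟩ := hL K
    exact ⟨Rec, (h Rec n hn hcpt).1⟩) (weakAut_of_langlands hL)

/-- both pieces are S-implied: `Langlands → FU ∧ UWA`. [folklore] -/
theorem cells_of_langlands (hL : _root_.Langlands) : FrobeniusUnits ∧ UnitWeakAutomorphy :=
  ⟨fu_of_langlands hL, uwa_of_target (weakAut_of_langlands hL)⟩

/-- EXACTNESS at the level of the target, modulo direction (A): `(A) → (B_w ↔ FU ∧ UWA)`. [folklore] -/
theorem cells_iff_target_modA
    (hA : ∀ (K : Type) [Field K] [NumberField K] (n : ℕ) (hcpt : isCompact_glFiniteIntegralLevel n K), 0 < n →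
      ∃ R : Summit.Langlands.ReciprocityData K, Summit.Langlands.AutomorphicToGalois n R hcpt) :
    Summit.Langlands.Langlands.Theses.PrimeSwitchSplit.WeakGeometricAutomorphy ↔ (FrobeniusUnits ∧ UnitWeakAutomorphy) :=
  ⟨fun h => ⟨fu_of_dirA_of_weakAut hA h, uwa_of_target h⟩, fun h => closes_host h.1 h.2⟩

/-- g32's crux is S-implied THROUGH this node (a second kernel path to `fa_of_langlands`): `Langlands → FU → FA`. [folklore] -/
theorem fa_of_langlands_via_fu (hL : _root_.Langlands) : FrobeniusAlgebraicity :=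
  fa_of_fu (fu_of_langlands hL)

end Kernel

/-! ## Rungs (BC5): PROVED instances of the deciding crux FU -/

section Rungs

open IsDedekindDomain NumberField Literature.NumberTheory.GaloisRepresentations

/-- the rung is a restriction of the crux. [folklore] -/
theorem finiteOrderUnitRung_of_fu (h : FrobeniusUnits) : FiniteOrderUnitRung :=
  fun K _ _ n hn ℓ _ ι ρ hirr _ hgeo => h K n hn ℓ ι ρ hirr hgeo

/-- **the finite-order rung HOLDS** (kernel, no sorry): FU for finite-order `ρ` (roots of unity). [folklore] -/
theorem finiteOrderUnitRung : FiniteOrderUnitRung :=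
  fun K _ _ n hn ℓ _ ι ρ _ hfin _ => by
    obtain ⟨k, hk, hρ⟩ := hfin
    exact hasUnitFrobenius_of_finiteOrder ι ρ hk hρ

/-- the rung is a restriction of the crux. [folklore] -/
theorem compatibleFamilyUnitRung_of_fu (h : FrobeniusUnits) : CompatibleFamilyUnitRung :=
  fun K _ _ n hn ℓ _ ι ρ hirr _ hgeo => h K n hn ℓ ι ρ hirr hgeo

/-- **the compatible-family rung HOLDS** (kernel, no sorry): FU for members of full compatible families — the deciding crux is a THEOREM on
the regime (all of étale cohomology) where the summit's weak automorphy is wide open. [folklore] -/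
theorem compatibleFamilyUnitRung : CompatibleFamilyUnitRung :=
  fun K _ _ n hn ℓ _ ι ρ _ hfam _ => by
    obtain ⟨S, hS, hfam⟩ := hfam
    exact hasUnitFrobenius_of_compatibleFamily ι ρ hS fun ℓ' _ ι' => hfam ℓ' ι'

/-- the S-case of the finite-order rung (g32's `ArtinCase`, tree decl by name) is a restriction of the residual UWA (finite order ⇒ unit
avatars, kernel) — and NOT a theorem. [folklore] -/
theorem artinCase_of_uwa (h : UnitWeakAutomorphy) : ArtinCase :=
  fun K _ _ n hcpt hn ℓ _ ι ρ hirr hfin hgeo => by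
    obtain ⟨k, hk, hρ⟩ := hfin
    exact h K n hcpt hn ℓ ι ρ hirr hgeo (hasUnitFrobenius_of_finiteOrder ι ρ hk hρ)

/-- the S-case of the compatible-family rung is a restriction of the host crux `B_w` … [folklore] -/
theorem compatibleFamilyCase_of_target (h : Summit.Langlands.Langlands.Theses.PrimeSwitchSplit.WeakGeometricAutomorphy) : CompatibleFamilyCase :=
  fun K _ _ n hcpt hn ℓ _ ι ρ hirr _ hgeo => h K n hcpt hn ℓ ι ρ hirr hgeo

/-- … and of the residual UWA (members of compatible families have unit avatars, kernel). [folklore] -/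
theorem compatibleFamilyCase_of_uwa (h : UnitWeakAutomorphy) : CompatibleFamilyCase :=
  fun K _ _ n hcpt hn ℓ _ ι ρ hirr hfam hgeo => by
    obtain ⟨S, hS, hfam⟩ := hfam
    exact h K n hcpt hn ℓ ι ρ hirr hgeo (hasUnitFrobenius_of_compatibleFamily ι ρ hS fun ℓ' _ ι' => hfam ℓ' ι')

end Rungs

end Summit.Langlands.Langlands.Theorems.FrobeniusUnitCarving
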